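import Literature.AnabelianGeometry.AbsoluteAnabelian.ProfiniteOuterSemidirectProduct
import HarnessLib

/-!
# The profinite `G ⋊^out J` carries the level topology of `OuterSemidirectProductTopology` ([SemiAnbd] §0 p. 5)

Mochizuki, *Semi-graphs of anabelioids*, Publ. RIMS **42** (2006), §0 p. 5 [cite: MochizukiSemiAnbd2006, §0 p.5].

COMPARISON (abc-iut cell, GAP row «G-P13-GR», abc-iut-w5-d151 g4): the GENERIC group topology of
`SemiGraphs/OuterSemidirectProductTopology.lean` on the algebraic `outerSemidirectProduct ρ`, taken
along the characteristic open cores `V_n = charOpenCore G n` (abc-iut-w4-d053), COINCIDES — along the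
comparison isomorphism `outerSemidirectProfiniteEquiv` of `ProfiniteOuterSemidirectProduct.lean` — with
the profinite (subspace-of-`profiniteAut hG × J`) topology of `outerSemidirectProfinite hG θ`:
`outerSemidirectProfiniteHomeomorph` (a continuous bijection from a compact space to a Hausdorff one).
So the generic layer, instantiated at a topologically finitely generated profinite `G`, IS the profinite
`G ⋊^out J`.  Nothing here bears on [IUTchIII] Cor. 3.12.
-/

namespace Literature.AnabelianGeometry.AbsoluteAnabelian

open Literature.AnabelianGeometry.EtaleTheta Literature.AnabelianGeometry.SemiGraphs
open Filter Topology

universe u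

variable {G : Type u} [Group G] [TopologicalSpace G]

/-- The characteristic open cores form a directed (antitone) family of levels.
[cite: MochizukiSemiAnbd2006, §0 p.5] -/
theorem charOpenCore_directed : Directed (· ≥ ·) (fun n : ℕ => charOpenCore G n) :=
  fun i j => ⟨max i j, charOpenCore_anti (le_max_left i j), charOpenCore_anti (le_max_right i j)⟩

variable [IsTopologicalGroup G] [CompactSpace G] (hG : IsTopologicallyFinitelyGenerated G)

/-- The level-`n` kernel `{a | a_n = 1}` of `profiniteAut hG` is OPEN (a coordinate of the product of
discrete groups). [cite: MochizukiSemiAnbd2006, §0 p.5] -/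
theorem isOpen_profiniteAut_level (n : ℕ) :
    IsOpen {a : profiniteAut hG | (a.1 n : contMulAut G ⧸ autLevelKer G n) = 1} := by
  letI τ : ∀ n : ℕ, TopologicalSpace (contMulAut G ⧸ autLevelKer G n) := fun _ => ⊥
  haveI : ∀ n : ℕ, DiscreteTopology (contMulAut G ⧸ autLevelKer G n) := fun _ => ⟨rfl⟩
  have hc : Continuous fun a : profiniteAut hG => (a.1 n : contMulAut G ⧸ autLevelKer G n) :=
    (continuous_apply n).comp continuous_subtype_val
  exact (isOpen_discrete ({1} : Set (contMulAut G ⧸ autLevelKer G n))).preimage hc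

variable [TotallyDisconnectedSpace G] {J : Type u} [Group J] [TopologicalSpace J]
  (θ : J →ₜ* outProfinite hG)

/-- The levels `V_n` are invariant under the (algebraic) outer action underlying `θ` (abc-iut-w4-d053's
`outerSemidirectProduct_fst_apply_mem_charOpenCore`). [cite: MochizukiSemiAnbd2006, §0 p.5] -/
theorem charOpenCore_invariant :
    ∀ (n : ℕ) (e : outerSemidirectProduct (outerActionOfContinuous hG θ)) (g : G),
      g ∈ charOpenCore G n → ((e.1.1 : contMulAut G) : MulAut G) g ∈ charOpenCore G n :=
  fun n e _ hg => outerSemidirectProduct_fst_apply_mem_charOpenCore _ n e hg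

variable [IsTopologicalGroup J]

/-- **The level topology** of `OuterSemidirectProductTopology.lean` on the algebraic `G ⋊^out J`, along
the characteristic open cores. [cite: MochizukiSemiAnbd2006, §0 p.5] -/
noncomputable abbrev levelTopology :
    TopologicalSpace (outerSemidirectProduct (outerActionOfContinuous hG θ)) :=
  outerSemidirectProduct.topology (outerActionOfContinuous hG θ) (fun n : ℕ => charOpenCore G n)
    charOpenCore_directed (charOpenCore_invariant hG θ)

/-- An element of `profiniteAut hG` with trivial level-`n` coordinate corresponds to an automorphism
congruent to the identity modulo `V_n`. [cite: MochizukiSemiAnbd2006, §0 p.5] -/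
theorem symm_mem_autLevelKer_of_level_eq_one {n : ℕ} {a : profiniteAut hG}
    (ha : (a.1 n : contMulAut G ⧸ autLevelKer G n) = 1) :
    (profiniteAutEquiv (hG := hG)).symm a ∈ autLevelKer G n := by
  have h : (toProfiniteAut hG ((profiniteAutEquiv (hG := hG)).symm a)).1 n = a.1 n :=
    congrArg (fun b : profiniteAut hG => b.1 n) ((profiniteAutEquiv (hG := hG)).apply_symm_apply a)
  rw [toProfiniteAut_apply, ha] at h
  exact (QuotientGroup.eq_one_iff _).mp h

/-- **The comparison isomorphism is CONTINUOUS** from the profinite `G ⋊^out J` to the algebraic one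
with the level topology: the basic neighbourhood `levelNhd V_n V` pulls back to the trace of the open
`{a | a_n = 1} × V`. [cite: MochizukiSemiAnbd2006, §0 p.5] -/
theorem continuous_outerSemidirectProfiniteEquiv :
    @Continuous (outerSemidirectSubgroup hG θ) (outerSemidirectProduct (outerActionOfContinuous hG θ))
      inferInstance (levelTopology hG θ) (outerSemidirectProfiniteEquiv hG θ) := by
  letI := levelTopology hG θ
  haveI := outerSemidirectProduct.isTopologicalGroup (outerActionOfContinuous hG θ)
    (fun n : ℕ => charOpenCore G n) charOpenCore_directed (charOpenCore_invariant hG θ)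
  refine continuous_of_continuousAt_one (outerSemidirectProfiniteEquiv hG θ).toMonoidHom ?_
  rw [ContinuousAt, map_one]
  refine ((outerSemidirectProduct.hasBasis_nhds_one (outerActionOfContinuous hG θ)
    (fun n : ℕ => charOpenCore G n) charOpenCore_directed (charOpenCore_invariant hG θ)).tendsto_right_iff).2 ?_
  rintro ⟨n, V⟩ hV
  change V ∈ 𝓝 (1 : J) at hV
  -- the trace of `{a | a_n = 1} × V` on the fibre product is a neighbourhood of `1`
  have hmem : (Subtype.val ⁻¹' ({a : profiniteAut hG | (a.1 n : contMulAut G ⧸ autLevelKer G n) = 1} ×ˢ V) :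
      Set (outerSemidirectSubgroup hG θ)) ∈ 𝓝 (1 : outerSemidirectSubgroup hG θ) :=
    continuous_subtype_val.continuousAt.preimage_mem_nhds
      (prod_mem_nhds ((isOpen_profiniteAut_level hG n).mem_nhds rfl) hV)
  refine Filter.mem_of_superset hmem ?_
  rintro p ⟨hp1, hp2⟩
  change (outerSemidirectProfiniteEquiv hG θ).toMonoidHom p ∈ outerSemidirectProduct.levelNhd
    (outerActionOfContinuous hG θ) (charOpenCore G n) V
  rw [outerSemidirectProduct.mem_levelNhd]
  exact ⟨mem_autLevelKer_iff.mp (symm_mem_autLevelKer_of_level_eq_one hG hp1), hp2⟩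

variable [CompactSpace J] [TotallyDisconnectedSpace J]

/-- **The profinite `G ⋊^out J` is HOMEOMORPHIC (along the comparison isomorphism) to the algebraic
`G ⋊^out J` with the level topology**: a continuous bijection from a compact space to a Hausdorff space.
[cite: MochizukiSemiAnbd2006, §0 p.5] -/
noncomputable def outerSemidirectProfiniteHomeomorph :
    @Homeomorph (outerSemidirectSubgroup hG θ) (outerSemidirectProduct (outerActionOfContinuous hG θ))
      inferInstance (levelTopology hG θ) := by
  letI := levelTopology hG θ
  haveI : CompactSpace (outerSemidirectSubgroup hG θ) :=
    isCompact_iff_compactSpace.mp (isClosed_outerSemidirectSubgroup hG θ).isCompact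
  haveI : T2Space (outerSemidirectProduct (outerActionOfContinuous hG θ)) :=
    outerSemidirectProduct.t2Space_of (outerActionOfContinuous hG θ) (fun n : ℕ => charOpenCore G n)
      charOpenCore_directed (charOpenCore_invariant hG θ) (fun U hU => exists_charOpenCore_subset (G := G) hU)
  exact Continuous.homeoOfEquivCompactToT2 (f := (outerSemidirectProfiniteEquiv hG θ).toEquiv)
    (continuous_outerSemidirectProfiniteEquiv hG θ)

/-- The homeomorphism is the comparison isomorphism. [cite: MochizukiSemiAnbd2006, §0 p.5] -/
theorem outerSemidirectProfiniteHomeomorph_apply (p : outerSemidirectSubgroup hG θ) :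
    outerSemidirectProfiniteHomeomorph hG θ p = outerSemidirectProfiniteEquiv hG θ p := rfl

/-- **The two topologies agree**: the level topology is the one transported from the profinite
`G ⋊^out J` along the comparison isomorphism. [cite: MochizukiSemiAnbd2006, §0 p.5] -/
theorem levelTopology_eq_coinduced :
    levelTopology hG θ = TopologicalSpace.coinduced (outerSemidirectProfiniteEquiv hG θ) inferInstance := by
  letI := levelTopology hG θ
  exact ((outerSemidirectProfiniteHomeomorph hG θ).coinduced_eq).symm

end Literature.AnabelianGeometry.AbsoluteAnabelian
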